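import Summits.NavierStokesRegularity.NavierStokesRegularity.Theorems.FrequencyRigidity.Negative.RigidRotation

/-!
# `FrequencyRigidity` (crux `stmt-NavierStokesRegularity-2955`): (C) the momentum equation is
# load-bearing — a backward self-similar swirl with `Λ ≡ 2` — negative-side support, file 3 of 3

`AdaptedFrequency.FrequencyRigidity = ¬ ∃ (ν C Λ₀ v q K), …`: no smooth ancient Navier–Stokes
flow on `ℝ³ × (−∞,0)` with the GLOBAL Type-I bound `‖v(t,x)‖ ≤ C/√(−t)`, an adapted two-sided
Gaussian-comparable kernel `K` at `(0,0)`, positive adapted enstrophy `H` and constant adapted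
frequency `Λ ≡ Λ₀`.  No `¬`-theorem of the crux is claimed (a witness would contain a non-trivial
bounded mild ancient solution with Type-I decay at both ends — open, excluded by the KNSS
Liouville conjecture; see the crux work-file `Cruxes/FrequencyRigidity/Disproof.lean`).  These
files prove WHICH hypotheses any proof must use, each by an explicit witness whose adapted kernel
is the backward heat kernel (it is adapted to every flow tangent to the spheres about the pole).

This file (theorems only; objects in `Negative/Clauses.lean`): keep joint smoothness on
`(−∞,0) × ℝ³`, incompressibility and the GLOBAL Type-I bound, but drop the momentum equation
(`FrequencyRigidityWithoutMomentum`).  Witness: the backward self-similar field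
`swirl t x = (−t)^{−1/2} V(x/√(−t))` with compactly supported smooth profile `V = χ · (e₃ × ·)`,
`χ(y) = smoothTransition(2 − ‖y‖²)` radial (`V = e₃ × y` on the unit ball): divergence-free
(`div (χ rot) = χ tr rot + Dχ(rot y) = 0`), `‖swirl‖ ≤ 2/√(−t)`, tangent to the spheres (heat
kernel adapted), and by parabolic scaling of the Bochner integral (`Measure.integral_comp_smul`)
its adapted enstrophy is the exact power law `H(t) = A/t²` with `A = ∫ ‖curl V‖² G_ν > 0`
(`adaptedEnstrophy_swirl`, `integral_F_pos`), so `H > 0` and `Λ ≡ 2`: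
`frequencyRigidity_false_without_momentum`.  The self-similar equality value `Λ₀ = 2` is thus
realised by kinematics + kernel structure alone; only the Navier–Stokes dynamics (NRŠ 1996 /
Tsai 1998) can exclude it — the endgame of the route is load-bearing.

## References

* G. Koch, N. Nadirashvili, G. Seregin, V. Šverák, *Liouville theorems for the Navier–Stokes
  equations and applications*, Acta Math. 203 (2009) 83–105. [KochNadirashviliSereginSverak2009]
* T.-P. Tsai, *On Leray's self-similar solutions of the Navier–Stokes equations satisfying local
  energy estimates*, Arch. Ration. Mech. Anal. 143 (1998) 29–51. [Tsai1998]
* C.-C. Poon, *Unique continuation for parabolic equations*, Comm. PDE 21 (1996) 521–539. [Poon1996]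
-/

noncomputable section

set_option linter.dupNamespace false

namespace Summit.NavierStokesRegularity.NavierStokesRegularity.Theorems.FrequencyRigidity.Negative

open Literature.Analysis.FluidPDE Literature.Analysis.UnboundedOperators
open MeasureTheory Set Filter Topology Function
open scoped Laplacian InnerProductSpace RealInnerProductSpace ContDiff

/-! ### (C) The momentum equation is load-bearing: a backward self-similar swirling field -/

/-- The cutoff is smooth. -/
theorem χ_contDiff {n : ℕ∞} : ContDiff ℝ n χ :=
  Real.smoothTransition.contDiff.comp (contDiff_const.sub (contDiff_norm_sq ℝ))

/-- The cutoff is `1` on the closed unit ball. -/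
theorem χ_eq_one {y : E3} (hy : ‖y‖ ^ 2 ≤ 1) : χ y = 1 :=
  Real.smoothTransition.one_of_one_le (by linarith)

/-- The cutoff vanishes where `‖y‖² ≥ 2`. -/
theorem χ_eq_zero {y : E3} (hy : 2 ≤ ‖y‖ ^ 2) : χ y = 0 :=
  Real.smoothTransition.zero_of_nonpos (by linarith)

/-- The cutoff is nonnegative. -/
theorem χ_nonneg (y : E3) : 0 ≤ χ y := Real.smoothTransition.nonneg _

/-- The cutoff is at most `1`. -/
theorem χ_le_one (y : E3) : χ y ≤ 1 := Real.smoothTransition.le_one _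

/-- The cutoff is radial: its derivative is a multiple of `⟪y, ·⟫`. -/
theorem hasFDerivAt_χ (y : E3) :
    HasFDerivAt χ (deriv Real.smoothTransition (2 - ‖y‖ ^ 2) • (-((2:ℕ) • innerSL ℝ y))) y := by
  have h1 : HasFDerivAt (fun y : E3 => 2 - ‖y‖ ^ 2) (-((2:ℕ) • innerSL ℝ y)) y := by
    simpa using (hasStrictFDerivAt_norm_sq y).hasFDerivAt.const_sub (2:ℝ)
  have h2 : HasDerivAt Real.smoothTransition (deriv Real.smoothTransition (2 - ‖y‖ ^ 2))
      (2 - ‖y‖ ^ 2) :=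
    ((Real.smoothTransition.contDiff (n := 1)).differentiable (by simp) _).hasDerivAt
  exact h2.comp_hasFDerivAt y h1

/-- The cutoff does not vary along the rotation field. -/
theorem fderiv_χ_rot (y : E3) : fderiv ℝ χ y (rot y) = 0 := by
  rw [(hasFDerivAt_χ y).fderiv]
  simp [inner_self_rot]

/-- The profile is smooth. -/
theorem V_contDiff {n : ℕ∞} : ContDiff ℝ n V := χ_contDiff.smul rot.contDiff

/-- The profile vanishes where `‖y‖² ≥ 2`. -/
theorem V_eq_zero {y : E3} (hy : 2 ≤ ‖y‖ ^ 2) : V y = 0 := by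
  simp [V, χ_eq_zero hy]

/-- The profile has compact support (in the closed ball of radius `2`). -/
theorem hasCompactSupport_V : HasCompactSupport V := by
  refine HasCompactSupport.intro (isCompact_closedBall (0:E3) 2) fun y hy => V_eq_zero ?_
  have h2 : 2 < ‖y‖ := by simpa [dist_eq_norm] using hy
  nlinarith

/-- The profile is bounded by `2`. -/
theorem norm_V_le (y : E3) : ‖V y‖ ≤ 2 := by
  by_cases hy : 2 ≤ ‖y‖ ^ 2
  · simp [V_eq_zero hy]
  · have h1 : ‖y‖ ≤ 2 := by nlinarith [norm_nonneg y]
    calc ‖V y‖ = χ y * ‖rot y‖ := by rw [V, norm_smul, Real.norm_of_nonneg (χ_nonneg y)]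
      _ ≤ 1 * ‖y‖ := mul_le_mul (χ_le_one y) (norm_rot_le y) (norm_nonneg _) zero_le_one
      _ ≤ 2 := by linarith

/-- The profile is tangent to the spheres about the origin. -/
theorem inner_self_V (y : E3) : ⟪y, V y⟫ = 0 := by
  rw [V, inner_smul_right, inner_self_rot, mul_zero]

/-- Product rule for the profile. -/
theorem hasFDerivAt_V (y : E3) :
    HasFDerivAt V (χ y • rot + (fderiv ℝ χ y).smulRight (rot y)) y :=
  (hasFDerivAt_χ y).differentiableAt.hasFDerivAt.smul rot.hasFDerivAt

/-- `tr (e₃ × ·) = 0`. -/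
theorem trace_rot : LinearMap.trace ℝ E3 (rot : E3 →ₗ[ℝ] E3) = 0 := by
  rw [LinearMap.trace_eq_sum_inner _ (stdOrthonormalBasis ℝ E3)]
  refine Finset.sum_eq_zero fun i _ => ?_
  have h1 := rot_skew (stdOrthonormalBasis ℝ E3 i) (stdOrthonormalBasis ℝ E3 i)
  rw [real_inner_comm] at h1
  simp only [ContinuousLinearMap.coe_coe]
  linarith

/-- The profile is divergence-free: `div (χ rot) = χ tr(rot) + Dχ(rot y) = 0 + 0`. -/
theorem divergence_V (y : E3) : VectorCalculus.divergence V y = 0 := by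
  rw [VectorCalculus.divergence, (hasFDerivAt_V y).fderiv, ContinuousLinearMap.toLinearMap_add,
    map_add, ContinuousLinearMap.toLinearMap_smul, map_smul, trace_rot, smul_zero, zero_add]
  rw [show ((fderiv ℝ χ y).smulRight (rot y) : E3 →ₗ[ℝ] E3) =
      ((fderiv ℝ χ y : E3 →L[ℝ] ℝ) : E3 →ₗ[ℝ] ℝ).smulRight (rot y) from rfl,
    LinearMap.trace_smulRight]
  exact fderiv_χ_rot y

/-- On a neighbourhood of the origin the profile IS rigid rotation. -/
theorem V_eventuallyEq_rot : V =ᶠ[𝓝 (0:E3)] (⇑rot) := by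
  have h : Metric.ball (0:E3) 1 ∈ 𝓝 (0:E3) := Metric.ball_mem_nhds 0 one_pos
  filter_upwards [h] with y hy
  have hy1 : ‖y‖ ^ 2 ≤ 1 := by
    have : ‖y‖ < 1 := by simpa using hy
    nlinarith [norm_nonneg y]
  simp [V, χ_eq_one hy1]

/-- At the origin the vorticity of the profile is `2e₃`. -/
theorem curl_V_zero : curl V 0 = (2:ℝ) • e₃ := by
  have h : fderiv ℝ V 0 = fderiv ℝ (⇑rot) 0 := V_eventuallyEq_rot.fderiv_eq
  have h2 : curl V 0 = curl (⇑rot) 0 := by simp only [curl, h]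
  rw [h2, curl_rot]

/-- Continuity of the curl of a `C¹` field. -/
theorem continuous_curl {W : E3 → E3} (hW : ContDiff ℝ 1 W) : Continuous fun y => curl W y := by
  have hc : Continuous (fderiv ℝ W) := hW.continuous_fderiv one_ne_zero
  have hD : ∀ j i : Fin 3, Continuous fun y => fderiv ℝ W y (EuclideanSpace.single j 1) i :=
    fun j i => (continuous_apply i).comp ((PiLp.continuous_ofLp 2 _).comp
      (hc.clm_apply continuous_const))
  unfold curl
  exact (PiLp.continuous_toLp 2 _).comp (((hD 1 2).sub (hD 2 1)).matrixVecCons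
    (((hD 2 0).sub (hD 0 2)).matrixVecCons (((hD 0 1).sub (hD 1 0)).matrixVecCons
      continuous_const)))

/-- The curl of a compactly supported field is compactly supported. -/
theorem hasCompactSupport_curl {W : E3 → E3} (hW : HasCompactSupport W) :
    HasCompactSupport fun y => curl W y := by
  have h := (hW.fderiv ℝ).comp_left (g := fun L : E3 →L[ℝ] E3 =>
    WithLp.toLp 2 ![L (EuclideanSpace.single 1 1) 2 - L (EuclideanSpace.single 2 1) 1,
      L (EuclideanSpace.single 2 1) 0 - L (EuclideanSpace.single 0 1) 2,
      L (EuclideanSpace.single 0 1) 1 - L (EuclideanSpace.single 1 1) 0]) (by simp)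
  exact h

/-! #### Parabolic self-similar scaling -/

/-- Chain rule for the parabolic rescaling `z ↦ c W(c z)`: its derivative is `c² DW(c z)`. -/
theorem hasFDerivAt_smul_comp_smul {W : E3 → E3} {W' : E3 →L[ℝ] E3} (c : ℝ) {x : E3}
    (hW : HasFDerivAt W W' (c • x)) :
    HasFDerivAt (fun z => c • W (c • z)) ((c * c) • W') x := by
  have h1 : HasFDerivAt (fun z : E3 => c • z) (c • ContinuousLinearMap.id ℝ E3) x :=
    (hasFDerivAt_id x).const_smul c
  have h2 := (hW.comp x h1).const_smul c
  refine h2.congr_fderiv (ContinuousLinearMap.ext fun z => ?_)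
  simp [mul_smul]

/-- `curl (c W(c ·)) (x) = c² (curl W)(c x)`. -/
theorem curl_smul_comp_smul {W : E3 → E3} (c : ℝ) (x : E3) (hW : DifferentiableAt ℝ W (c • x)) :
    curl (fun z => c • W (c • z)) x = (c * c) • curl W (c • x) := by
  simp only [curl, (hasFDerivAt_smul_comp_smul c hW.hasFDerivAt).fderiv]
  ext i
  fin_cases i <;> simp [mul_sub]

/-- `div (c W(c ·)) (x) = c² (div W)(c x)`. -/
theorem divergence_smul_comp_smul {W : E3 → E3} (c : ℝ) (x : E3)
    (hW : DifferentiableAt ℝ W (c • x)) :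
    VectorCalculus.divergence (fun z => c • W (c • z)) x =
      (c * c) * VectorCalculus.divergence W (c • x) := by
  rw [VectorCalculus.divergence, (hasFDerivAt_smul_comp_smul c hW.hasFDerivAt).fderiv,
    ContinuousLinearMap.toLinearMap_smul, map_smul, VectorCalculus.divergence, smul_eq_mul]

/-- `sc t > 0` when `−t > 0`. -/
theorem sc_pos {t : ℝ} (ht : 0 < -t) : 0 < sc t := inv_pos.2 (Real.sqrt_pos.2 ht)

/-- `sc(t)² = (−t)⁻¹`. -/
theorem sc_mul_sc {t : ℝ} (ht : t < 0) : sc t * sc t = (-t)⁻¹ := by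
  rw [sc, ← mul_inv, Real.mul_self_sqrt (by linarith)]

/-- `sc(t)⁴ = t⁻²`. -/
theorem sc_pow_four {t : ℝ} (ht : t < 0) : sc t ^ 4 = (t ^ 2)⁻¹ := by
  rw [show sc t ^ 4 = (sc t * sc t) * (sc t * sc t) by ring, sc_mul_sc ht]
  field_simp

/-- `sc` is smooth on `t < 0`. -/
theorem sc_contDiffAt {t : ℝ} (ht : t < 0) {n : WithTop ℕ∞} : ContDiffAt ℝ n sc t := by
  have h1 : ContDiffAt ℝ n (fun s : ℝ => Real.sqrt (-s)) t :=
    (Real.contDiffAt_sqrt (by linarith : -t ≠ 0)).comp t contDiffAt_id.neg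
  exact h1.inv (Real.sqrt_ne_zero'.2 (by linarith))

/-- The witness field is jointly smooth on `(−∞,0) × ℝ³`. -/
theorem isSmoothSpaceTimeOn_swirl : IsSmoothSpaceTimeOn (Iio 0) swirl := by
  rintro ⟨t, x⟩ ⟨ht, -⟩
  apply ContDiffAt.contDiffWithinAt
  have hsc : ContDiffAt ℝ ∞ (fun p : ℝ × E3 => sc p.1) (t, x) :=
    ContDiffAt.comp (t, x) (g := sc) (f := Prod.fst) (sc_contDiffAt (show t < 0 from ht))
      contDiffAt_fst
  have hV : ContDiffAt ℝ ∞ (fun p : ℝ × E3 => V (sc p.1 • p.2)) (t, x) :=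
    (V_contDiff (n := ⊤)).contDiffAt.comp (t, x) (hsc.smul contDiffAt_snd)
  exact hsc.smul hV

/-- The witness field is divergence-free at every time. -/
theorem isDivFree_swirl (t : ℝ) : VectorCalculus.IsDivFree (swirl t) := by
  intro x
  show VectorCalculus.divergence (fun z => sc t • V (sc t • z)) x = 0
  rw [divergence_smul_comp_smul _ _ (hasFDerivAt_V _).differentiableAt, divergence_V, mul_zero]

/-- The witness field obeys the GLOBAL Type-I bound with constant `2`. -/
theorem typeIBound_swirl : TypeIBound 2 swirl := by
  intro t ht x
  have hsc := sc_pos (neg_pos.2 (show t < 0 from ht))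
  rw [swirl, norm_smul, Real.norm_of_nonneg hsc.le, sc, div_eq_mul_inv, mul_comm]
  exact mul_le_mul_of_nonneg_right (norm_V_le _) (inv_nonneg.2 (Real.sqrt_nonneg _))

/-- The witness field is tangent to the spheres about the origin. -/
theorem inner_self_swirl (t : ℝ) (x : E3) : ⟪x, swirl t x⟫ = 0 := by
  rw [swirl, inner_smul_right]
  rcases eq_or_ne (sc t) 0 with h | h
  · simp [h]
  · have := inner_self_V (sc t • x)
    rw [inner_smul_left] at this
    simp only [conj_trivial, mul_eq_zero, h, false_or] at this
    rw [this, mul_zero]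

/-- Scaling of the vorticity: `curl (swirl t)(x) = (−t)⁻¹ (curl V)(x/√(−t))`. -/
theorem curl_swirl (t : ℝ) (x : E3) :
    curl (swirl t) x = (sc t * sc t) • curl V (sc t • x) :=
  curl_smul_comp_smul (sc t) x (hasFDerivAt_V _).differentiableAt

/-- Scaling of the model kernel: `K(t,x) = sc(t)³ G_ν(sc(t) x)`. -/
theorem backwardHeatKernel_scaling {ν : ℝ} (hν : 0 < ν) {t : ℝ} (ht : t < 0) (x : E3) :
    backwardHeatKernel ν 0 (0:E3) t x = sc t ^ 3 * heatKernel ν (sc t • x) := by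
  have hs : 0 < -t := by linarith
  rw [backwardHeatKernel_zero_eq]
  simp only [heatKernel, finrank_euclideanSpace_fin, Nat.cast_ofNat]
  have h1 : ‖sc t • x‖ ^ 2 = ‖x‖ ^ 2 / (-t) := by
    rw [norm_smul, mul_pow, Real.norm_of_nonneg (sc_pos hs).le, sq (sc t), sc_mul_sc ht]
    ring
  have h2 : (4 * Real.pi * (ν * (0 - t))) ^ (-(3:ℝ) / 2) =
      sc t ^ 3 * (4 * Real.pi * ν) ^ (-(3:ℝ) / 2) := by
    rw [show 4 * Real.pi * (ν * (0 - t)) = (4 * Real.pi * ν) * (-t) by ring,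
      Real.mul_rpow (by positivity) hs.le, mul_comm]
    congr 1
    rw [sc, inv_pow, Real.sqrt_eq_rpow, ← Real.rpow_natCast, ← Real.rpow_mul hs.le,
      ← Real.rpow_neg hs.le]
    norm_num
  rw [h1, h2]
  have h3 : -(‖x‖ ^ 2 / -t) / (4 * ν) = -‖x‖ ^ 2 / (4 * (ν * (0 - t))) := by
    field_simp
    ring
  rw [h3]
  ring

/-- The profile enstrophy density is continuous. -/
theorem continuous_F (ν : ℝ) : Continuous (F ν) :=
  ((continuous_curl (V_contDiff (n := 1))).norm.pow 2).mul (continuous_heatKernel ν)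

/-- The profile enstrophy density has compact support. -/
theorem hasCompactSupport_F (ν : ℝ) : HasCompactSupport (F ν) := by
  have h1 : HasCompactSupport fun y => ‖curl V y‖ ^ 2 :=
    (hasCompactSupport_curl hasCompactSupport_V).norm.comp_left (g := fun r : ℝ => r ^ 2) (by simp)
  show HasCompactSupport ((fun y => ‖curl V y‖ ^ 2) * heatKernel ν)
  exact h1.mul_right

/-- The profile enstrophy density is nonnegative. -/
theorem F_nonneg {ν : ℝ} (hν : 0 < ν) (y : E3) : 0 ≤ F ν y :=
  mul_nonneg (sq_nonneg _) (heatKernel_pos hν _).le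

/-- The profile enstrophy density does not vanish at the origin. -/
theorem F_zero_ne {ν : ℝ} (hν : 0 < ν) : F ν 0 ≠ 0 := by
  have h1 : ‖curl V 0‖ ^ 2 = 4 := by
    rw [curl_V_zero, norm_smul, e₃, PiLp.norm_single]
    norm_num
  rw [F, h1]
  exact mul_ne_zero (by norm_num) (heatKernel_pos hν _).ne'

/-- `A = ∫ F > 0`: the profile enstrophy is positive. -/
theorem integral_F_pos {ν : ℝ} (hν : 0 < ν) : 0 < ∫ y, F ν y :=
  (continuous_F ν).integral_pos_of_hasCompactSupport_nonneg_nonzero (hasCompactSupport_F ν)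
    (F_nonneg hν) (F_zero_ne hν)

/-- **Exact power law**: the adapted enstrophy of the witness is `H(t) = A / t²`, i.e.
`A (−t)^{−2}` — constant adapted frequency `Λ ≡ 2`. -/
theorem adaptedEnstrophy_swirl {ν : ℝ} (hν : 0 < ν) {t : ℝ} (ht : t < 0) :
    (∫ x, ‖curl (swirl t) x‖ ^ 2 * backwardHeatKernel ν 0 (0:E3) t x) =
      (∫ y, F ν y) / t ^ 2 := by
  have hsc := sc_pos (neg_pos.2 ht)
  have h1 : ∀ x, ‖curl (swirl t) x‖ ^ 2 * backwardHeatKernel ν 0 (0:E3) t x =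
      sc t ^ 7 * F ν (sc t • x) := fun x => by
    rw [curl_swirl, backwardHeatKernel_scaling hν ht, norm_smul, F,
      Real.norm_of_nonneg (mul_pos hsc hsc).le]
    ring
  simp_rw [h1, integral_const_mul]
  rw [Measure.integral_comp_smul volume (F ν) (sc t)]
  simp only [finrank_euclideanSpace_fin, smul_eq_mul]
  rw [abs_of_pos (inv_pos.2 (pow_pos hsc 3)), div_eq_mul_inv, ← sc_pow_four ht]
  field_simp

/-- The frequency clause holds for the witness with `Λ₀ = 2` (`H(t) = A/t²`, `A > 0`). -/
theorem freqClause_swirl {ν : ℝ} (hν : 0 < ν) :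
    FreqClause swirl (backwardHeatKernel ν 0 (0:E3)) 2 := by
  intro H Λ hH hΛ
  set A : ℝ := ∫ y, F ν y with hA
  have hApos : 0 < A := integral_F_pos hν
  have hHt : ∀ t ∈ Iio (0:ℝ), H t = A / t ^ 2 := fun t ht => by
    rw [hH]; exact adaptedEnstrophy_swirl hν ht
  refine ⟨fun t ht => ?_, fun t ht => ?_⟩
  · rw [hHt t ht]
    have ht0 : t ≠ 0 := ne_of_lt ht
    positivity
  · have ht0 : t ≠ 0 := ne_of_lt ht
    have hev : H =ᶠ[𝓝 t] fun s => A * (s ^ 2)⁻¹ :=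
      Filter.eventuallyEq_of_mem (Iio_mem_nhds ht) fun s hs => by
        rw [hHt s hs, div_eq_mul_inv]
    have hd : HasDerivAt (fun s : ℝ => A * (s ^ 2)⁻¹) (A * (-(2 * t) / (t ^ 2) ^ 2)) t := by
      have h1 : HasDerivAt (fun s : ℝ => s ^ 2) (2 * t) t := by simpa using hasDerivAt_pow 2 t
      exact (h1.inv (pow_ne_zero 2 ht0)).const_mul A
    rw [hΛ]
    dsimp only
    rw [hev.deriv_eq, hd.deriv, hHt t ht]
    field_simp
    ring

/-- The variant is a strengthening of the crux. -/
theorem frequencyRigidity_of_withoutMomentum (h : FrequencyRigidityWithoutMomentum) :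
    Theses.AdaptedFrequency.FrequencyRigidity := by
  rw [frequencyRigidity_iff]
  rintro ⟨ν, C, Λ₀, v, q, K, hν, hNS, hTI, hK, hC, hF⟩
  exact h ⟨ν, C, Λ₀, v, K, hν, hNS.smooth_velocity, hNS.divFree, hTI, hK, hC, hF⟩

/-- **(C)** Dropping the momentum equation makes the crux FALSE: the backward self-similar
swirl `swirl t x = (−t)^{−1/2} V(x/√(−t))`, `V = χ · (e₃ × ·)`, is jointly smooth on
`(−∞,0) × ℝ³`, divergence-free, obeys the GLOBAL Type-I bound with `C = 2`, the backward heat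
kernel is an adapted comparable kernel for it (the field is tangent to the spheres about the
pole), its adapted enstrophy is `H(t) = A/t²` with `A > 0`, so `H > 0` and `Λ ≡ 2`.
Consequently the value `Λ₀ = 2` (the self-similar equality case) is realised by the kinematics
and the kernel structure alone; only the Navier–Stokes dynamics (NRŠ/Tsai) can exclude it. -/
theorem frequencyRigidity_false_without_momentum : ¬ FrequencyRigidityWithoutMomentum := by
  intro h
  exact h ⟨1, 2, 2, swirl, backwardHeatKernel 1 0 (0:E3), one_pos, isSmoothSpaceTimeOn_swirl,
    fun t _ => isDivFree_swirl t, typeIBound_swirl,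
    kernelClauses_backwardHeatKernel one_pos _ (fun t _ x => inner_self_swirl t x),
    comparable_backwardHeatKernel one_pos, freqClause_swirl one_pos⟩

end Summit.NavierStokesRegularity.NavierStokesRegularity.Theorems.FrequencyRigidity.Negative
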